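import Literature.Computability.QuantumComplexity.PauliParseval
import Mathlib.LinearAlgebra.Matrix.Rank
import Mathlib.LinearAlgebra.FiniteDimensional.Basic
import Mathlib.Data.Fin.Tuple.Basic
import Mathlib.Algebra.BigOperators.Fin
import HarnessLib

/-!
# Decision diagrams for register states: Pauli-LIM isomorphism, level widths, Pauli-LIMDDs

The dictionary between the decision-diagram simulators of quantum circuits (QMDD / SLDD×,
Pauli-LIMDD) and counting problems on a register state `f : (ι → Bool) → ℂ`, after
Vinkhuijzen–Coopmans–Elkouss–Dunjko–Laarman, *LIMDD: a decision diagram for simulation of quantum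
computing including stabilizer states*, Quantum 7 (2023) 1108 [VinkhuijzenEtAl2023] and
Vinkhuijzen–Coopmans–Laarman, *A knowledge compilation map for quantum information* (2024)
[VinkhuijzenCoopmansLaarman2024]:

* `PauliIso f g` — `f = μ · (P₁ ⊗ ⋯ ⊗ P_m) g` for a Pauli string `P` and a scalar `μ ≠ 0`: the
  `⟨Pauli⟩`-isomorphism of [VinkhuijzenEtAl2023, Def. 1] (a `G`-LIM is `λ Oₙ ⊗ ⋯ ⊗ O₁`, `Oᵢ ∈ G`,
  `λ ∈ ℂ ∖ {0}`; `|φ⟩ ≃_G |ψ⟩` iff `O|φ⟩ = |ψ⟩` for such an `O`), an equivalence relation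
  (`PauliIso.setoid`), invariant under relabelling the wires (`PauliIso.of_reindex`); the product
  table of Pauli letters (`Pauli.mat_mul_mat`) and strings (`pauliString_mul`) it rests on;
  `ScalarIso f g` — `f = μ g`, `μ ≠ 0` (the merging rule of QMDD / SLDD×,
  [VinkhuijzenCoopmansLaarman2024, Table 1]).
* `subfunctionAt S f u` — the induced subfunction ("cofactor") of `f` obtained by fixing the
  variables in the prefix set `S : Finset ι` to `u`, a function of the remaining variables
  `↥(Sᶜ) → Bool` ([VinkhuijzenCoopmansLaarman2024, App. A.2: `f_y(x) = f(y, x)`]);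
  `prefixVars σ d` — the first `d` variables of a variable order `σ : Fin n ≃ ι`;
  `unfolding S f` — the matrix `(u, v) ↦ f(u ⊔ v)` whose rows are the subfunctions.
* `limClassCount S f` — the number of `PauliIso`-classes of NONZERO subfunctions at `S`, and
  `pauliLIMDDWidth σ d f := limClassCount (prefixVars σ d) f`; `sliceClassCount` / `qmddWidth` —
  the same with `ScalarIso` (QMDD / SLDD×). [VinkhuijzenCoopmansLaarman2024, Prop. 1]: a reduced
  QDD for `f` has exactly as many nodes on a level as there are induced subfunctions modulo the
  diagram's isomorphism; [VinkhuijzenCoopmansLaarman2024, Lemma 4] uses the count of pairwise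
  non-Pauli-isomorphic level subfunctions as the node lower bound in every variable order.
  API: `card_le_limClassCount` (a family of assignments with nonzero, pairwise non-isomorphic
  subfunctions has at most `limClassCount` members — the form in which route items state LIMDD
  lower bounds), `exists_limClassCount_transversal`, `limClassCount_le_sliceClassCount`,
  `rank_unfolding_le_sliceClassCount` (Schmidt rank across the cut `S | Sᶜ` ≤ QMDD width).
* `PauliLIMDD n` — the data structure of [VinkhuijzenEtAl2023, Def. 2] with `G = ⟨Pauli⟩`: nodes
  sorted by qubit index `k` (a node of index `k` represents a vector on `k` qubits), a unique leaf
  of index `0` with `|Leaf⟩ = 1`, every other node has a low and a high child of index one less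
  (no skipped qubits) along edges labelled by Pauli-LIMs `μ · P` or `0`, semantics
  `|v⟩ = |0⟩ ⊗ |low edge⟩ + |1⟩ ⊗ |high edge⟩`, `|e⟩ = label(e) · |target⟩`, and a labelled root
  edge; `D.Represents σ f` says the root edge represents `f` read in the variable order `σ`.
  **Theorem `PauliLIMDD.limClassCount_le_card`**: if `D` represents `f` in order `σ` then for
  `d + k = n` the number of nodes of index `k` is at least `limClassCount (prefixVars σ d) f` —
  the lower-bound half of [VinkhuijzenCoopmansLaarman2024, Prop. 1], valid for every (not
  necessarily reduced) Pauli-LIMDD, proved by following root-to-node paths as in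
  [VinkhuijzenEtAl2023, §3.1 (amplitude read-off)] / [VinkhuijzenCoopmansLaarman2024, App. A.2];
  `PauliLIMDD.sliceClassCount_le_card_of_isQMDD` is the QMDD (`G = {I}`) version.

What is NOT here: the reduction rules and the canonicity theorem [VinkhuijzenEtAl2023, Def. 5,
Thm. 9] (existence of a reduced Pauli-LIMDD attaining the widths), the manipulation algorithms,
and `⟨X⟩`/`⟨Z⟩`-LIMDDs.

## References

* [VinkhuijzenEtAl2023] L. Vinkhuijzen, T. Coopmans, D. Elkouss, V. Dunjko, A. Laarman, Quantum 7
  (2023) 1108 = arXiv:2108.00931: Def. 1 (p. 8), Def. 2 and the semantics (pp. 9–10), §3.1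
  amplitude read-off (p. 10), Def. 5 and Thm. 9 (pp. 24–26).
* [VinkhuijzenCoopmansLaarman2024] L. Vinkhuijzen, T. Coopmans, A. Laarman, arXiv:2401.01322:
  §2.2 (QDD, Table 1, Def. 2), App. A.2 (subfunctions, Prop. 1), Lemma 4.

## Mathlib / tree search

Mathlib has no decision diagrams (`lean search 'OBDD|QMDD|LIMDD|DecisionDiagram'`: none); Boolean
subfunction counting in Nechiporuk's style exists as `Literature.Barriers.PneNP.subfunction`
(`(Fin n → Bool) → Bool`, free block `Y`), not reusable for complex amplitudes indexed by the
complement of a prefix. Pauli strings: `Literature.Computability.QuantumComplexity.pauliString`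
(`PauliExpansion.lean`, `PauliParseval.lean`: `tensorAll_mul`, `pauliString_mul_self`).
-/

noncomputable section

open Matrix Finset

namespace Literature.Computability.QuantumComplexity

/-! ### Products of Pauli letters; the single nonzero entry in each row -/

namespace Pauli

/-- The letter of the product `σ_Q σ_P` (the Pauli group modulo phases: `X·Y = Z` etc.).
[folklore] -/
def letterMul : Pauli → Pauli → Pauli
  | I, I => I
  | I, X => X
  | I, Y => Y
  | I, Z => Z
  | X, I => X
  | X, X => I
  | X, Y => Z
  | X, Z => Y
  | Y, I => Y
  | Y, X => Z
  | Y, Y => I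
  | Y, Z => X
  | Z, I => Z
  | Z, X => Y
  | Z, Y => X
  | Z, Z => I

/-- The phase of the product `σ_Q σ_P = phase · σ_{Q·P}`: `XY = iZ`, `YZ = iX`, `ZX = iY`, the
reversed products carry `-i`, all other products carry `1`. [folklore] -/
def letterPhase : Pauli → Pauli → ℂ
  | I, I => 1
  | I, X => 1
  | I, Y => 1
  | I, Z => 1
  | X, I => 1
  | X, X => 1
  | X, Y => Complex.I
  | X, Z => -Complex.I
  | Y, I => 1
  | Y, X => -Complex.I
  | Y, Y => 1
  | Y, Z => Complex.I
  | Z, I => 1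
  | Z, X => Complex.I
  | Z, Y => -Complex.I
  | Z, Z => 1

/-- **Product table of the Pauli matrices**: `σ_Q σ_P = phase(Q,P) · σ_{Q·P}`. [folklore] -/
theorem mat_mul_mat (Q P : Pauli) : mat Q * mat P = letterPhase Q P • mat (letterMul Q P) := by
  ext a b
  simp only [Matrix.smul_apply, smul_eq_mul, mul_apply_bool]
  cases Q <;> cases P <;> cases a <;> cases b <;> simp [letterPhase, letterMul]

/-- The phases are units. [folklore] -/
theorem letterPhase_ne_zero (Q P : Pauli) : letterPhase Q P ≠ 0 := by
  cases Q <;> cases P <;> simp [letterPhase, Complex.I_ne_zero]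

/-- Whether the letter flips the computational basis (`X`, `Y`) or not (`I`, `Z`). [folklore] -/
def flipsBit : Pauli → Bool
  | I => false
  | X => true
  | Y => true
  | Z => false

/-- The unique nonzero entry in row `a` of `σ_Q`: `⟨a| σ_Q = rowPhase Q a · ⟨a ⊕ flipsBit Q|`.
[cite: VinkhuijzenEtAl2023, §3.1 (⟨x|A = γ⟨y| for a Pauli-LIM A)] -/
def rowPhase : Pauli → Bool → ℂ
  | I, _ => 1
  | X, _ => 1
  | Y, false => -Complex.I
  | Y, true => Complex.I
  | Z, false => 1
  | Z, true => -1

/-- Entries of a Pauli matrix: a single nonzero entry `rowPhase Q a` in row `a`, in column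
`a ⊕ flipsBit Q`. [folklore] -/
theorem mat_apply_eq_ite (Q : Pauli) (a b : Bool) :
    mat Q a b = if b = Bool.xor a Q.flipsBit then rowPhase Q a else 0 := by
  cases Q <;> cases a <;> cases b <;> simp [flipsBit, rowPhase]

/-- The row phases are units. [folklore] -/
theorem rowPhase_ne_zero (Q : Pauli) (a : Bool) : rowPhase Q a ≠ 0 := by
  cases Q <;> cases a <;> simp [rowPhase, Complex.I_ne_zero]

/-- Contracting a row of a Pauli matrix against a `Bool`-indexed family picks out one member:
`Σ_b (σ_Q)_{a b} • V b = rowPhase Q a • V (a ⊕ flipsBit Q)`.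
[cite: VinkhuijzenEtAl2023, §3.1 (⟨x|A = γ⟨y|)] -/
theorem sum_mat_smul {M : Type*} [AddCommGroup M] [Module ℂ M] (Q : Pauli) (a : Bool)
    (V : Bool → M) : ∑ b, mat Q a b • V b = rowPhase Q a • V (Bool.xor a Q.flipsBit) := by
  rw [Fintype.sum_bool]
  cases Q <;> cases a <;> simp [flipsBit, rowPhase]

end Pauli

/-! ### Products of Pauli strings -/

section Strings

variable {κ : Type*} [Fintype κ] [DecidableEq κ]

omit [DecidableEq κ] in
/-- Scalars come out of a tensor product as their product: `⊗ (cᵢ Aᵢ) = (∏ cᵢ) ⊗ Aᵢ`. [folklore] -/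
theorem tensorAll_smul (c : κ → ℂ) (A : κ → Matrix Bool Bool ℂ) :
    tensorAll (fun i => c i • A i) = (∏ i, c i) • tensorAll A := by
  ext x y
  simp only [tensorAll_apply, Matrix.smul_apply, smul_eq_mul]
  exact Finset.prod_mul_distrib

/-- The letterwise product of two Pauli strings. [folklore] -/
def stringMul (P Q : κ → Pauli) : κ → Pauli := fun i => (P i).letterMul (Q i)

/-- The phase `∏ᵢ phase(Pᵢ, Qᵢ) ∈ {±1, ±i}` of the product of two Pauli strings. [folklore] -/
def stringPhase (P Q : κ → Pauli) : ℂ := ∏ i, (P i).letterPhase (Q i)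

omit [DecidableEq κ] in
/-- The phase of a product of strings is a unit. [folklore] -/
theorem stringPhase_ne_zero (P Q : κ → Pauli) : stringPhase P Q ≠ 0 :=
  Finset.prod_ne_zero_iff.mpr fun _ _ => Pauli.letterPhase_ne_zero _ _

/-- **Pauli strings form a group up to phases**: `(⊗ Pᵢ)(⊗ Qᵢ) = (∏ phase) · ⊗ (Pᵢ Qᵢ)`.
[cite: VinkhuijzenEtAl2023, §3.1 (PauliLIMₙ is a group; λ absorbs γ = ±1, ±i)] -/
theorem pauliString_mul (P Q : κ → Pauli) :
    pauliString P * pauliString Q = stringPhase P Q • pauliString (stringMul P Q) := by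
  rw [pauliString_eq, pauliString_eq, tensorAll_mul]
  simp only [Pauli.mat_mul_mat]
  rw [tensorAll_smul]
  rfl

/-! ### Pauli-LIM isomorphism -/

/-- **`⟨Pauli⟩`-isomorphism** of two vectors on the register `κ → Bool`: `f = μ · (⊗ᵢ Pᵢ) g` for
some Pauli string `P` and some scalar `μ ≠ 0`, i.e. `f` is the image of `g` under a Pauli-LIM
`μ P ∈ PauliLIM`. [cite: VinkhuijzenEtAl2023, Def. 1 (G-LIM, G-isomorphism, G = ⟨Pauli⟩)] -/
def PauliIso (f g : (κ → Bool) → ℂ) : Prop :=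
  ∃ (P : κ → Pauli) (μ : ℂ), μ ≠ 0 ∧ f = μ • (pauliString P).mulVec g

namespace PauliIso

/-- Reflexivity (the identity string). [cite: VinkhuijzenEtAl2023, Def. 1 (≃_G is an equivalence relation)] -/
theorem refl (f : (κ → Bool) → ℂ) : PauliIso f f :=
  ⟨fun _ => Pauli.I, 1, one_ne_zero, by rw [pauliString_const_I, Matrix.one_mulVec, one_smul]⟩

/-- Symmetry (Pauli strings are involutions). [cite: VinkhuijzenEtAl2023, Def. 1 (≃_G is an equivalence relation)] -/
theorem symm {f g : (κ → Bool) → ℂ} (h : PauliIso f g) : PauliIso g f := by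
  obtain ⟨P, μ, hμ, rfl⟩ := h
  refine ⟨P, μ⁻¹, inv_ne_zero hμ, ?_⟩
  rw [Matrix.mulVec_smul, Matrix.mulVec_mulVec, pauliString_mul_self, Matrix.one_mulVec, smul_smul,
    inv_mul_cancel₀ hμ, one_smul]

/-- Transitivity (strings multiply to strings up to phase). [cite: VinkhuijzenEtAl2023, Def. 1 (≃_G is an equivalence relation)] -/
theorem trans {f g h : (κ → Bool) → ℂ} (h₁ : PauliIso f g) (h₂ : PauliIso g h) : PauliIso f h := by
  obtain ⟨P, μ, hμ, rfl⟩ := h₁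
  obtain ⟨Q, ν, hν, rfl⟩ := h₂
  refine ⟨stringMul P Q, μ * (ν * stringPhase P Q),
    mul_ne_zero hμ (mul_ne_zero hν (stringPhase_ne_zero P Q)), ?_⟩
  rw [Matrix.mulVec_smul, Matrix.mulVec_mulVec, pauliString_mul, Matrix.smul_mulVec]
  simp only [smul_smul]

/-- `PauliIso` is an equivalence relation. [cite: VinkhuijzenEtAl2023, Def. 1] -/
theorem equivalence : Equivalence (@PauliIso κ _ _) := ⟨refl, symm, trans⟩

variable (κ) in
/-- The setoid of `⟨Pauli⟩`-isomorphism on vectors over the register `κ → Bool`.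
[cite: VinkhuijzenEtAl2023, Def. 1] -/
def setoid : Setoid ((κ → Bool) → ℂ) := ⟨PauliIso, equivalence⟩

/-- A NONZERO vector written as `μ · P g` is Pauli-isomorphic to `g` (the scalar is then
automatically nonzero). [folklore] -/
theorem of_eq {f g : (κ → Bool) → ℂ} {P : κ → Pauli} {μ : ℂ} (hf : f ≠ 0)
    (h : f = μ • (pauliString P).mulVec g) : PauliIso f g := by
  refine ⟨P, μ, ?_, h⟩
  rintro rfl
  exact hf (by rw [h, zero_smul])

/-- Isomorphic vectors vanish together. [folklore] -/
theorem eq_zero_iff {f g : (κ → Bool) → ℂ} (h : PauliIso f g) : f = 0 ↔ g = 0 := by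
  constructor
  · intro hf
    obtain ⟨P, μ, -, hg⟩ := h.symm
    rw [hg, hf, Matrix.mulVec_zero, smul_zero]
  · intro hg
    obtain ⟨P, μ, -, hf⟩ := h
    rw [hf, hg, Matrix.mulVec_zero, smul_zero]

/-- For a nonzero `f`, dropping the condition `μ ≠ 0` does not change the relation (the form in
which route items spell out "not Pauli-isomorphic"). [folklore] -/
theorem iff_exists_of_ne_zero {f g : (κ → Bool) → ℂ} (hf : f ≠ 0) :
    PauliIso f g ↔ ∃ (P : κ → Pauli) (μ : ℂ), f = μ • (pauliString P).mulVec g :=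
  ⟨fun ⟨P, μ, _, h⟩ => ⟨P, μ, h⟩, fun ⟨_, _, h⟩ => of_eq hf h⟩

end PauliIso

end Strings

/-! ### Scalar isomorphism (QMDD / SLDD× merging) -/

section Scalar

/-- **Scalar isomorphism** `f = μ g`, `μ ≠ 0` — the node-merging relation of QMDDs / SLDD×
(`G = {I}`-LIMs). [cite: VinkhuijzenCoopmansLaarman2024, Table 1 (SLDD×, QMDD: f = p·g)] -/
def ScalarIso {X : Type*} (f g : X → ℂ) : Prop :=
  ∃ μ : ℂ, μ ≠ 0 ∧ f = μ • g

namespace ScalarIso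

variable {X : Type*}

/-- Reflexivity. [folklore] -/
theorem refl (f : X → ℂ) : ScalarIso f f := ⟨1, one_ne_zero, (one_smul _ _).symm⟩

/-- Symmetry. [folklore] -/
theorem symm {f g : X → ℂ} (h : ScalarIso f g) : ScalarIso g f := by
  obtain ⟨μ, hμ, rfl⟩ := h
  exact ⟨μ⁻¹, inv_ne_zero hμ, by rw [smul_smul, inv_mul_cancel₀ hμ, one_smul]⟩

/-- Transitivity. [folklore] -/
theorem trans {f g h : X → ℂ} (h₁ : ScalarIso f g) (h₂ : ScalarIso g h) : ScalarIso f h := by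
  obtain ⟨μ, hμ, rfl⟩ := h₁
  obtain ⟨ν, hν, rfl⟩ := h₂
  exact ⟨μ * ν, mul_ne_zero hμ hν, by rw [smul_smul]⟩

variable (X) in
/-- The setoid of scalar isomorphism. [cite: VinkhuijzenCoopmansLaarman2024, Def. 2 (isomorphic nodes, E_k = ℂ)] -/
def setoid : Setoid (X → ℂ) := ⟨ScalarIso, refl, symm, trans⟩

/-- A nonzero vector written as `μ g` is scalar-isomorphic to `g`. [folklore] -/
theorem of_eq {f g : X → ℂ} {μ : ℂ} (hf : f ≠ 0) (h : f = μ • g) : ScalarIso f g := by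
  refine ⟨μ, ?_, h⟩
  rintro rfl
  exact hf (by rw [h, zero_smul])

/-- Scalar-isomorphic vectors are Pauli-isomorphic (identity string). [folklore] -/
theorem toPauliIso {κ : Type*} [Fintype κ] [DecidableEq κ] {f g : (κ → Bool) → ℂ}
    (h : ScalarIso f g) : PauliIso f g := by
  obtain ⟨μ, hμ, rfl⟩ := h
  exact ⟨fun _ => Pauli.I, μ, hμ, by rw [pauliString_const_I, Matrix.one_mulVec]⟩

end ScalarIso

end Scalar

/-! ### Relabelling the wires -/

section Reindex

variable {κ κ' : Type*}

/-- Transport of a vector along a bijection of wire sets: `(reindexFun e f) x = f (x ∘ e)`.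
[folklore] -/
def reindexFun (e : κ ≃ κ') (f : (κ → Bool) → ℂ) : (κ' → Bool) → ℂ := fun x => f (x ∘ e)

/-- Unfolding of `reindexFun`. [folklore] -/
theorem reindexFun_apply (e : κ ≃ κ') (f : (κ → Bool) → ℂ) (x : κ' → Bool) :
    reindexFun e f x = f (x ∘ e) := rfl

/-- Transporting back and forth. [folklore] -/
theorem reindexFun_symm_reindexFun (e : κ ≃ κ') (f : (κ → Bool) → ℂ) :
    reindexFun e.symm (reindexFun e f) = f := by
  funext x
  simp only [reindexFun, Function.comp_assoc, Equiv.symm_comp_self, Function.comp_id]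

/-- Transport is linear (scalars). [folklore] -/
theorem reindexFun_smul (e : κ ≃ κ') (μ : ℂ) (f : (κ → Bool) → ℂ) :
    reindexFun e (μ • f) = μ • reindexFun e f := rfl

/-- Transport detects the zero vector. [folklore] -/
theorem reindexFun_eq_zero_iff (e : κ ≃ κ') (f : (κ → Bool) → ℂ) : reindexFun e f = 0 ↔ f = 0 := by
  constructor
  · intro h
    rw [← reindexFun_symm_reindexFun e f, h]
    rfl
  · rintro rfl
    rfl

/-- Precomposition with a bijection of wires is a bijection of registers. [folklore] -/
theorem comp_equiv_bijective (e : κ ≃ κ') : Function.Bijective fun y : κ' → Bool => y ∘ e :=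
  (e.arrowCongr (Equiv.refl Bool)).symm.bijective

/-- `ScalarIso` is reflected by relabelling the wires. [folklore] -/
theorem ScalarIso.of_reindex (e : κ ≃ κ') {f g : (κ → Bool) → ℂ}
    (h : ScalarIso (reindexFun e f) (reindexFun e g)) : ScalarIso f g := by
  obtain ⟨μ, hμ, h⟩ := h
  refine ⟨μ, hμ, ?_⟩
  rw [← reindexFun_symm_reindexFun e f, h, ← reindexFun_smul, reindexFun_symm_reindexFun]

variable [Fintype κ] [Fintype κ'] [DecidableEq κ] [DecidableEq κ']

omit [DecidableEq κ] [DecidableEq κ'] in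
/-- Entries of a relabelled Pauli string. [folklore] -/
theorem pauliString_comp_equiv_apply (e : κ ≃ κ') (P : κ → Pauli) (x y : κ' → Bool) :
    pauliString (P ∘ e.symm) x y = pauliString P (x ∘ e) (y ∘ e) := by
  simp only [pauliString_eq, tensorAll_apply, Function.comp_apply]
  symm
  exact Fintype.prod_equiv e _ _ fun i => by simp

/-- Transport intertwines Pauli strings: `(P g) ∘ e = (P ∘ e⁻¹)(g ∘ e)`. [folklore] -/
theorem reindexFun_pauliString_mulVec (e : κ ≃ κ') (P : κ → Pauli) (g : (κ → Bool) → ℂ) :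
    reindexFun e ((pauliString P).mulVec g) = (pauliString (P ∘ e.symm)).mulVec (reindexFun e g) := by
  funext x
  simp only [reindexFun, Matrix.mulVec, dotProduct]
  symm
  refine Fintype.sum_bijective (fun y : κ' → Bool => y ∘ e) (comp_equiv_bijective e) _ _ fun y => ?_
  rw [pauliString_comp_equiv_apply]

/-- `PauliIso` is preserved by relabelling the wires. [folklore] -/
theorem PauliIso.reindex (e : κ ≃ κ') {f g : (κ → Bool) → ℂ} (h : PauliIso f g) :
    PauliIso (reindexFun e f) (reindexFun e g) := by
  obtain ⟨P, μ, hμ, rfl⟩ := h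
  exact ⟨P ∘ e.symm, μ, hμ, by rw [reindexFun_smul, reindexFun_pauliString_mulVec]⟩

/-- `PauliIso` is reflected by relabelling the wires. [folklore] -/
theorem PauliIso.of_reindex (e : κ ≃ κ') {f g : (κ → Bool) → ℂ}
    (h : PauliIso (reindexFun e f) (reindexFun e g)) : PauliIso f g := by
  simpa only [reindexFun_symm_reindexFun] using h.reindex e.symm

end Reindex

/-! ### Counting classes of a setoid met on a finite set -/

section ClassCount

variable {α β : Type*}

/-- The number of `s`-classes met by `g` on the finite set `F` (the number of distinct values of
`a ↦ ⟦g a⟧`, `a ∈ F`). [folklore] -/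
def classCount (s : Setoid β) (g : α → β) (F : Finset α) : ℕ :=
  ((fun a => Quotient.mk s (g a)) '' (F : Set α)).ncard

/-- `classCount` as the cardinality of a `Finset.image` (any decidability instance). [folklore] -/
theorem classCount_eq_card_image (s : Setoid β) [DecidableEq (Quotient s)] (g : α → β) (F : Finset α) :
    classCount s g F = (F.image fun a => Quotient.mk s (g a)).card := by
  rw [classCount, ← Finset.coe_image, Set.ncard_coe_finset]

/-- A subfamily of `F` with pairwise inequivalent values has at most `classCount` members.
[folklore] -/
theorem card_le_classCount (s : Setoid β) (g : α → β) {F A : Finset α} (hAF : A ⊆ F)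
    (hA : ∀ a ∈ A, ∀ a' ∈ A, a ≠ a' → ¬ s.r (g a) (g a')) : A.card ≤ classCount s g F := by
  classical
  rw [classCount_eq_card_image]
  calc A.card = (A.image fun a => Quotient.mk s (g a)).card := by
        rw [Finset.card_image_of_injOn]
        intro a ha a' ha' h
        by_contra hne
        exact hA a ha a' ha' hne (Quotient.exact h)
    _ ≤ (F.image fun a => Quotient.mk s (g a)).card := by
        refine Finset.card_le_card fun c hc => ?_
        obtain ⟨a, ha, rfl⟩ := Finset.mem_image.mp hc
        exact Finset.mem_image_of_mem _ (hAF ha)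

/-- A **transversal**: `classCount` members of `F` with pairwise inequivalent values, meeting every
class met on `F`. [folklore] -/
theorem exists_transversal (s : Setoid β) (g : α → β) (F : Finset α) :
    ∃ A ⊆ F, A.card = classCount s g F ∧
      (∀ a ∈ A, ∀ a' ∈ A, a ≠ a' → ¬ s.r (g a) (g a')) ∧
      ∀ a ∈ F, ∃ a' ∈ A, s.r (g a) (g a') := by
  classical
  set T := F.image fun a => Quotient.mk s (g a) with hT
  have hmem : ∀ c ∈ T, ∃ a ∈ F, Quotient.mk s (g a) = c := fun c hc => Finset.mem_image.mp hc
  choose rep hrepF hrep using hmem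
  have hinj : Function.Injective fun c : {c // c ∈ T} => rep c.1 c.2 := by
    intro c c' h
    apply Subtype.ext
    rw [← hrep c.1 c.2, ← hrep c'.1 c'.2]
    exact congrArg (fun a => Quotient.mk s (g a)) h
  refine ⟨T.attach.image fun c => rep c.1 c.2, ?_, ?_, ?_, ?_⟩
  · intro a ha
    obtain ⟨c, -, rfl⟩ := Finset.mem_image.mp ha
    exact hrepF c.1 c.2
  · rw [classCount_eq_card_image, Finset.card_image_of_injective _ hinj, Finset.card_attach]
  · intro a ha a' ha' hne hr
    obtain ⟨c, -, rfl⟩ := Finset.mem_image.mp ha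
    obtain ⟨c', -, rfl⟩ := Finset.mem_image.mp ha'
    apply hne
    have hcc : c.1 = c'.1 := by
      rw [← hrep c.1 c.2, ← hrep c'.1 c'.2]
      exact Quotient.sound hr
    cases Subtype.ext hcc
    rfl
  · intro a ha
    have hc : Quotient.mk s (g a) ∈ T := Finset.mem_image_of_mem _ ha
    exact ⟨rep _ hc, Finset.mem_image.mpr ⟨⟨_, hc⟩, Finset.mem_attach _ _, rfl⟩,
      Quotient.exact (hrep _ hc).symm⟩

/-- Coarser relations have fewer classes. [folklore] -/
theorem classCount_le_of_imp {s₁ s₂ : Setoid β} (h : ∀ x y, s₁.r x y → s₂.r x y) (g : α → β)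
    (F : Finset α) : classCount s₂ g F ≤ classCount s₁ g F := by
  classical
  rw [classCount_eq_card_image, classCount_eq_card_image]
  let φ : Quotient s₁ → Quotient s₂ :=
    Quotient.lift (fun x => Quotient.mk s₂ x) fun x y hxy => Quotient.sound (h x y hxy)
  have hφ : (F.image fun a => Quotient.mk s₂ (g a)) = (F.image fun a => Quotient.mk s₁ (g a)).image φ := by
    rw [Finset.image_image]
    rfl
  rw [hφ]
  exact Finset.card_image_le

end ClassCount

/-! ### Prefix sets, induced subfunctions, level widths -/

section Widths

variable {ι : Type*} [Fintype ι] [DecidableEq ι]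

/-- The **induced subfunction** (cofactor) of `f` at the prefix assignment `u` on `S`:
`v ↦ f(u ⊔ v)` on the remaining variables (only `u|_S` matters).
[cite: VinkhuijzenCoopmansLaarman2024, App. A.2 (f_y(x) = f(y, x))] -/
def subfunctionAt (S : Finset ι) (f : (ι → Bool) → ℂ) (u : ι → Bool) : (↥(Sᶜ) → Bool) → ℂ :=
  fun v => f fun i => if h : i ∈ S then u i else v ⟨i, Finset.mem_compl.mpr h⟩

/-- Unfolding of `subfunctionAt`. [folklore] -/
theorem subfunctionAt_apply (S : Finset ι) (f : (ι → Bool) → ℂ) (u : ι → Bool) (v : ↥(Sᶜ) → Bool) :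
    subfunctionAt S f u v = f (fun i => if h : i ∈ S then u i else v ⟨i, Finset.mem_compl.mpr h⟩) :=
  rfl

/-- The subfunction only depends on the prefix assignment restricted to `S`. [folklore] -/
theorem subfunctionAt_congr {S : Finset ι} {f : (ι → Bool) → ℂ} {u u' : ι → Bool}
    (h : ∀ i ∈ S, u i = u' i) : subfunctionAt S f u = subfunctionAt S f u' := by
  funext v
  simp only [subfunctionAt]
  congr 1
  funext i
  split_ifs with hi
  exacts [h i hi, rfl]

/-- The first `d` variables of the variable order `σ : Fin n ≃ ι` (position `j` holds variable
`σ j`). [cite: VinkhuijzenCoopmansLaarman2024, §2.2 (variable orders)] -/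
def prefixVars {n : ℕ} (σ : Fin n ≃ ι) (d : ℕ) : Finset ι :=
  (Finset.univ.filter fun j : Fin n => (j : ℕ) < d).image σ

omit [Fintype ι] in
/-- Membership in the prefix: the position of the variable is `< d`. [folklore] -/
theorem mem_prefixVars {n : ℕ} {σ : Fin n ≃ ι} {d : ℕ} {i : ι} :
    i ∈ prefixVars σ d ↔ ((σ.symm i : Fin n) : ℕ) < d := by
  simp only [prefixVars, Finset.mem_image, Finset.mem_filter, Finset.mem_univ, true_and]
  constructor
  · rintro ⟨j, hj, rfl⟩
    simpa using hj
  · intro h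
    exact ⟨σ.symm i, h, σ.apply_symm_apply i⟩

open Classical in
/-- The prefix assignments whose subfunction is not the zero vector (zero cofactors get no node of
their own: the zero-edge rule). [cite: VinkhuijzenEtAl2023, Def. 2 (label 0) and Def. 5 (zero edges)] -/
def nonzeroPatterns (S : Finset ι) (f : (ι → Bool) → ℂ) : Finset (ι → Bool) :=
  Finset.univ.filter fun u => subfunctionAt S f u ≠ 0

/-- Membership in `nonzeroPatterns`. [folklore] -/
theorem mem_nonzeroPatterns {S : Finset ι} {f : (ι → Bool) → ℂ} {u : ι → Bool} :
    u ∈ nonzeroPatterns S f ↔ subfunctionAt S f u ≠ 0 := by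
  simp [nonzeroPatterns]

/-- **Pauli-LIMDD width of `f` at the prefix set `S`**: the number of `⟨Pauli⟩`-isomorphism
classes of NONZERO induced subfunctions `subfunctionAt S f u` (the zero cofactor is discarded: it
is carried by a `0`-labelled edge and has no node of its own in a reduced Pauli-LIMDD,
[VinkhuijzenEtAl2023, Def. 5 (zero edges) and the remark that the 0-vector has no reduced LIMDD]).
By [VinkhuijzenCoopmansLaarman2024, Prop. 1] (reduced QDDs have as many nodes on a level as
induced subfunctions modulo isomorphism) this is the node count of the reduced Pauli-LIMDD of `f`
on the level below `S`; `PauliLIMDD.limClassCount_le_card` proves the lower-bound half for every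
Pauli-LIMDD. [cite: VinkhuijzenCoopmansLaarman2024, Prop. 1 and Lemma 4] -/
def limClassCount (S : Finset ι) (f : (ι → Bool) → ℂ) : ℕ :=
  classCount (PauliIso.setoid ↥(Sᶜ)) (subfunctionAt S f) (nonzeroPatterns S f)

/-- **Pauli-LIMDD width at level `d` of the variable order `σ`**: `limClassCount` at the prefix of
the first `d` variables. [cite: VinkhuijzenCoopmansLaarman2024, Prop. 1 and Lemma 4] -/
def pauliLIMDDWidth {n : ℕ} (σ : Fin n ≃ ι) (d : ℕ) (f : (ι → Bool) → ℂ) : ℕ :=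
  limClassCount (prefixVars σ d) f

/-- **QMDD / SLDD× width of `f` at the prefix set `S`**: the number of nonzero induced subfunctions
up to nonzero scalars. [cite: VinkhuijzenCoopmansLaarman2024, Prop. 1 (E_k = ℂ) and Table 1] -/
def sliceClassCount (S : Finset ι) (f : (ι → Bool) → ℂ) : ℕ :=
  classCount (ScalarIso.setoid (↥(Sᶜ) → Bool)) (subfunctionAt S f) (nonzeroPatterns S f)

/-- **QMDD width at level `d` of the variable order `σ`**. [cite: VinkhuijzenCoopmansLaarman2024, Prop. 1 (E_k = ℂ)] -/
def qmddWidth {n : ℕ} (σ : Fin n ≃ ι) (d : ℕ) (f : (ι → Bool) → ℂ) : ℕ :=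
  sliceClassCount (prefixVars σ d) f

/-- Unfolding of `pauliLIMDDWidth`. [folklore] -/
theorem pauliLIMDDWidth_eq {n : ℕ} (σ : Fin n ≃ ι) (d : ℕ) (f : (ι → Bool) → ℂ) :
    pauliLIMDDWidth σ d f = limClassCount (prefixVars σ d) f := rfl

/-- Unfolding of `qmddWidth`. [folklore] -/
theorem qmddWidth_eq {n : ℕ} (σ : Fin n ≃ ι) (d : ℕ) (f : (ι → Bool) → ℂ) :
    qmddWidth σ d f = sliceClassCount (prefixVars σ d) f := rfl

/-- **Lower-bounding the width by a fooling family**: assignments with nonzero, pairwise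
non-Pauli-isomorphic subfunctions are at most `limClassCount` in number.
[cite: VinkhuijzenCoopmansLaarman2024, Lemma 4 (proof: each subfunction requires a separate node)] -/
theorem card_le_limClassCount {S : Finset ι} {f : (ι → Bool) → ℂ} (A : Finset (ι → Bool))
    (h0 : ∀ u ∈ A, subfunctionAt S f u ≠ 0)
    (hA : ∀ u ∈ A, ∀ u' ∈ A, u ≠ u' → ¬ PauliIso (subfunctionAt S f u) (subfunctionAt S f u')) :
    A.card ≤ limClassCount S f :=
  card_le_classCount _ _ (fun u hu => mem_nonzeroPatterns.mpr (h0 u hu)) hA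

/-- The same with "not isomorphic" spelled out without the condition `μ ≠ 0` (the literal shape
of the route items `LimClassesEveryOrder` / `LimNaturalOrder`). [folklore] -/
theorem card_le_limClassCount' {S : Finset ι} {f : (ι → Bool) → ℂ} (A : Finset (ι → Bool))
    (hA : ∀ u ∈ A, subfunctionAt S f u ≠ 0 ∧ ∀ u' ∈ A, u ≠ u' →
      ¬ ∃ (P : ↥(Sᶜ) → Pauli) (μ : ℂ),
        subfunctionAt S f u = μ • (pauliString P).mulVec (subfunctionAt S f u')) :
    A.card ≤ limClassCount S f :=
  card_le_limClassCount A (fun u hu => (hA u hu).1) fun u hu u' hu' hne hiso =>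
    (hA u hu).2 u' hu' hne ((PauliIso.iff_exists_of_ne_zero (hA u hu).1).mp hiso)

/-- A transversal of the Pauli-isomorphism classes of nonzero subfunctions: `limClassCount`
assignments with nonzero, pairwise non-isomorphic subfunctions, meeting every class. [folklore] -/
theorem exists_limClassCount_transversal (S : Finset ι) (f : (ι → Bool) → ℂ) :
    ∃ A : Finset (ι → Bool), A.card = limClassCount S f ∧
      (∀ u ∈ A, subfunctionAt S f u ≠ 0) ∧
      (∀ u ∈ A, ∀ u' ∈ A, u ≠ u' → ¬ PauliIso (subfunctionAt S f u) (subfunctionAt S f u')) ∧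
      ∀ u, subfunctionAt S f u ≠ 0 → ∃ u' ∈ A, PauliIso (subfunctionAt S f u) (subfunctionAt S f u') := by
  obtain ⟨A, hAF, hcard, hpair, hcov⟩ :=
    exists_transversal (PauliIso.setoid ↥(Sᶜ)) (subfunctionAt S f) (nonzeroPatterns S f)
  exact ⟨A, hcard, fun u hu => mem_nonzeroPatterns.mp (hAF hu), hpair,
    fun u hu => hcov u (mem_nonzeroPatterns.mpr hu)⟩

/-- A transversal of the scalar classes of nonzero subfunctions. [folklore] -/
theorem exists_sliceClassCount_transversal (S : Finset ι) (f : (ι → Bool) → ℂ) :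
    ∃ A : Finset (ι → Bool), A.card = sliceClassCount S f ∧
      (∀ u ∈ A, subfunctionAt S f u ≠ 0) ∧
      (∀ u ∈ A, ∀ u' ∈ A, u ≠ u' → ¬ ScalarIso (subfunctionAt S f u) (subfunctionAt S f u')) ∧
      ∀ u, subfunctionAt S f u ≠ 0 → ∃ u' ∈ A, ScalarIso (subfunctionAt S f u) (subfunctionAt S f u') := by
  obtain ⟨A, hAF, hcard, hpair, hcov⟩ :=
    exists_transversal (ScalarIso.setoid (↥(Sᶜ) → Bool)) (subfunctionAt S f) (nonzeroPatterns S f)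
  exact ⟨A, hcard, fun u hu => mem_nonzeroPatterns.mp (hAF hu), hpair,
    fun u hu => hcov u (mem_nonzeroPatterns.mpr hu)⟩

/-- LIMDDs merge at least as much as QMDDs: the Pauli width is at most the scalar width.
[cite: VinkhuijzenEtAl2023, §3.1 (any state efficiently represented by QMDD is so by a G-LIMDD)] -/
theorem limClassCount_le_sliceClassCount (S : Finset ι) (f : (ι → Bool) → ℂ) :
    limClassCount S f ≤ sliceClassCount S f :=
  classCount_le_of_imp (fun _ _ h => ScalarIso.toPauliIso h) _ _

/-- Local coordinates of the suffix: position `d + i` holds the `i`-th remaining variable, a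
bijection `Fin k ≃ ↥(prefixVars σ d)ᶜ` when `d + k = n`. [folklore] -/
def suffixEquiv {n : ℕ} (σ : Fin n ≃ ι) {d k : ℕ} (h : d + k = n) : Fin k ≃ ↥((prefixVars σ d)ᶜ) where
  toFun j := ⟨σ ⟨d + j, by omega⟩, by
    rw [Finset.mem_compl, mem_prefixVars, Equiv.symm_apply_apply]
    show ¬ (d + (j : ℕ) < d)
    omega⟩
  invFun c := ⟨((σ.symm c : Fin n) : ℕ) - d, by
    have hc := c.2
    rw [Finset.mem_compl, mem_prefixVars, not_lt] at hc
    have := (σ.symm c : Fin n).2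
    omega⟩
  left_inv j := by
    ext
    simp
  right_inv c := by
    have hc : d ≤ ((σ.symm c : Fin n) : ℕ) := by
      have h2 := c.2
      rw [Finset.mem_compl, mem_prefixVars, not_lt] at h2
      exact h2
    apply Subtype.ext
    have hfin : (⟨d + (((σ.symm c : Fin n) : ℕ) - d), by omega⟩ : Fin n) = σ.symm c :=
      Fin.ext (show d + (((σ.symm c : Fin n) : ℕ) - d) = ((σ.symm c : Fin n) : ℕ) by omega)
    show σ ⟨d + (((σ.symm c : Fin n) : ℕ) - d), _⟩ = (c : ι)
    rw [hfin, Equiv.apply_symm_apply]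

/-- The **unfolding** of `f` across the cut `S | Sᶜ`: the matrix `(u, v) ↦ f(u ⊔ v)` with rows
indexed by assignments of `S` and columns by assignments of `Sᶜ` (its rank is the Schmidt rank of
`f` across the cut; its rows are the induced subfunctions). [folklore] -/
def unfolding (S : Finset ι) (f : (ι → Bool) → ℂ) : Matrix (↥S → Bool) (↥(Sᶜ) → Bool) ℂ :=
  Matrix.of fun u v => f fun i => if h : i ∈ S then u ⟨i, h⟩ else v ⟨i, Finset.mem_compl.mpr h⟩

/-- Every row of the unfolding is an induced subfunction. [folklore] -/
theorem unfolding_row_eq (S : Finset ι) (f : (ι → Bool) → ℂ) (u : ↥S → Bool) :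
    unfolding S f u = subfunctionAt S f (fun i => if h : i ∈ S then u ⟨i, h⟩ else false) := by
  funext v
  simp only [unfolding, Matrix.of_apply, subfunctionAt]
  congr 1
  funext i
  split_ifs <;> rfl

/-- **Schmidt rank ≤ QMDD width**: the rank of the unfolding across `S | Sᶜ` is at most the number
of nonzero subfunctions up to scalars (the rows span a space of dimension ≤ the number of distinct
row directions). The published counterpart: an SLDD× with `D_ℓ` nodes on layer `ℓ` is an MPS with
bond dimensions `D_ℓ` [VinkhuijzenCoopmansLaarman2024, Lemma 39], and bond dimension bounds the
Schmidt rank. [folklore] -/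
theorem rank_unfolding_le_sliceClassCount (S : Finset ι) (f : (ι → Bool) → ℂ) :
    (unfolding S f).rank ≤ sliceClassCount S f := by
  classical
  obtain ⟨A, hcard, -, -, hcov⟩ := exists_sliceClassCount_transversal S f
  rw [← hcard, Matrix.rank_eq_finrank_span_row]
  set R : Finset ((↥(Sᶜ) → Bool) → ℂ) := A.image (subfunctionAt S f) with hR
  have hsub : Set.range (unfolding S f).row ⊆
      (Submodule.span ℂ (R : Set ((↥(Sᶜ) → Bool) → ℂ)) : Set ((↥(Sᶜ) → Bool) → ℂ)) := by
    rintro _ ⟨u, rfl⟩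
    rw [Matrix.row_apply', unfolding_row_eq]
    by_cases hz : subfunctionAt S f (fun i => if h : i ∈ S then u ⟨i, h⟩ else false) = 0
    · rw [hz]
      exact Submodule.zero_mem _
    · obtain ⟨u', hu', μ, -, hμ⟩ := hcov _ hz
      rw [hμ]
      exact Submodule.smul_mem _ _
        (Submodule.subset_span (Finset.mem_coe.mpr (Finset.mem_image_of_mem _ hu')))
  calc Module.finrank ℂ (Submodule.span ℂ (Set.range (unfolding S f).row))
      ≤ Module.finrank ℂ (Submodule.span ℂ (R : Set ((↥(Sᶜ) → Bool) → ℂ))) :=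
        Submodule.finrank_mono (Submodule.span_le.mpr hsub)
    _ ≤ R.card := finrank_span_finset_le_card R
    _ ≤ A.card := Finset.card_image_le

end Widths

/-! ### Pauli-LIMDDs -/

/-- An **`n`-qubit Pauli-LIMDD** [VinkhuijzenEtAl2023, Def. 2 with `G = ⟨Pauli⟩`]: for every
qubit index `k` a finite type `Node k` of nodes of index `k` (a node of index `k` represents a
vector on `k` qubits; indices above `n` are unreachable and irrelevant), a unique node of index
`0` (the leaf, `|Leaf⟩ = 1`), for every node of index `k + 1` a low and a high child of index `k`
(no qubit is skipped) together with the labels of the two edges, and a root node of index `n`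
with the label of the root edge. An edge label is a Pauli-LIM `μ · P_k ⊗ ⋯ ⊗ P_1` recorded as
the pair `(μ, P)`; the label `0` of Def. 2 is any pair with `μ = 0`.
[cite: VinkhuijzenEtAl2023, Def. 2] -/
structure PauliLIMDD (n : ℕ) where
  /-- the nodes of each qubit index -/
  Node : ℕ → Type
  /-- finitely many nodes of each index -/
  instFintype : ∀ k, Fintype (Node k)
  /-- the leaf is the unique node of index `0` -/
  instUnique : Unique (Node 0)
  /-- the low child (index one less) -/
  low : ∀ {k : ℕ}, Node (k + 1) → Node k
  /-- the high child (index one less) -/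
  high : ∀ {k : ℕ}, Node (k + 1) → Node k
  /-- the label `(μ, P)` of the low edge: the Pauli-LIM `μ · ⊗ P`, or `0` when `μ = 0` -/
  lowLabel : ∀ {k : ℕ}, Node (k + 1) → ℂ × (Fin k → Pauli)
  /-- the label of the high edge -/
  highLabel : ∀ {k : ℕ}, Node (k + 1) → ℂ × (Fin k → Pauli)
  /-- the root node, of index `n` -/
  root : Node n
  /-- the label of the root edge -/
  rootLabel : ℂ × (Fin n → Pauli)

namespace PauliLIMDD

variable {n : ℕ} (D : PauliLIMDD n)

/-- The nodes of each index form a finite type. [cite: VinkhuijzenEtAl2023, Def. 2 (Node is a set of nodes)] -/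
instance instFintypeNode (k : ℕ) : Fintype (D.Node k) := D.instFintype k

/-- The child along the bit `b` (`false` = low, `true` = high). [cite: VinkhuijzenEtAl2023, Def. 2] -/
def child (b : Bool) {k : ℕ} (v : D.Node (k + 1)) : D.Node k := bif b then D.high v else D.low v

/-- The label of the edge along the bit `b`. [cite: VinkhuijzenEtAl2023, Def. 2] -/
def label (b : Bool) {k : ℕ} (v : D.Node (k + 1)) : ℂ × (Fin k → Pauli) :=
  bif b then D.highLabel v else D.lowLabel v

/-- Semantics of a labelled edge: `|e⟩ = label(e) · |v⟩ = μ · (⊗ P) |v⟩`.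
[cite: VinkhuijzenEtAl2023, Def. 2 (semantics, |e⟩ ≜ label(e)·|v⟩)] -/
def edgeSem {k : ℕ} (lab : ℂ × (Fin k → Pauli)) (g : (Fin k → Bool) → ℂ) : (Fin k → Bool) → ℂ :=
  lab.1 • (pauliString lab.2).mulVec g

/-- Semantics of a node: `|Leaf⟩ = 1` and `|v⟩ = |0⟩ ⊗ |low_v⟩ + |1⟩ ⊗ |high_v⟩`, the first tensor
factor being the node's own (top) qubit, coordinate `0` of `Fin (k + 1) → Bool`.
[cite: VinkhuijzenEtAl2023, Def. 2 (semantics)] -/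
def nodeSem : (k : ℕ) → D.Node k → (Fin k → Bool) → ℂ
  | 0, _ => fun _ => 1
  | k + 1, v => fun x => edgeSem (D.label (x 0) v) (nodeSem k (D.child (x 0) v)) (Fin.tail x)

/-- The vector represented by the diagram: the semantics of the root edge.
[cite: VinkhuijzenEtAl2023, Def. 2 (e_root)] -/
def rootSem : (Fin n → Bool) → ℂ := edgeSem D.rootLabel (D.nodeSem n D.root)

/-- Unfolding of `rootSem`. [folklore] -/
theorem rootSem_eq : D.rootSem = D.rootLabel.1 • (pauliString D.rootLabel.2).mulVec (D.nodeSem n D.root) :=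
  rfl

/-- `D` **represents** the register vector `f : (ι → Bool) → ℂ` in the variable order
`σ : Fin n ≃ ι` (the root tests variable `σ 0`, its children `σ 1`, …): the amplitude the diagram
assigns to the assignment `x` of the positions is `f` at the assignment `i ↦ x (σ⁻¹ i)` of the
variables. [cite: VinkhuijzenCoopmansLaarman2024, §2.2 (QDD semantics and variable orders)] -/
def Represents {ι : Type*} (σ : Fin n ≃ ι) (f : (ι → Bool) → ℂ) : Prop :=
  ∀ x : Fin n → Bool, D.rootSem x = f fun i => x (σ.symm i)

/-- The number of nodes of index `k`. [cite: VinkhuijzenCoopmansLaarman2024, Prop. 1 (nodes on a level)] -/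
def levelCard (k : ℕ) : ℕ := Fintype.card (D.Node k)

/-- The number of non-leaf nodes (indices `1, …, n`), the node count entering the size of
[VinkhuijzenEtAl2023, Def. 2] / [VinkhuijzenCoopmansLaarman2024, §2.2 (|α| = |V| + |E| + labels)].
[cite: VinkhuijzenCoopmansLaarman2024, §2.2] -/
def nodeCount : ℕ := ∑ k ∈ Finset.range n, Fintype.card (D.Node (k + 1))

/-- A level count is at most the node count. [folklore] -/
theorem levelCard_le_nodeCount {k : ℕ} (hk : 1 ≤ k) (hkn : k ≤ n) : D.levelCard k ≤ D.nodeCount := by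
  obtain ⟨k, rfl⟩ : ∃ k', k = k' + 1 := ⟨k - 1, by omega⟩
  exact Finset.single_le_sum (f := fun k => Fintype.card (D.Node (k + 1))) (fun _ _ => Nat.zero_le _)
    (Finset.mem_range.mpr (by omega))

/-- `D` is a **QMDD** (a `{I}`-LIMDD, [VinkhuijzenEtAl2023, §3.1]): all edge labels are scalars
times the identity string. [cite: VinkhuijzenEtAl2023, §3.1 (G = {I} yields precisely all QMDDs)] -/
def IsQMDD (D : PauliLIMDD n) : Prop :=
  (∀ (k : ℕ) (v : D.Node (k + 1)) (b : Bool), (D.label b v).2 = fun _ => Pauli.I) ∧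
    D.rootLabel.2 = fun _ => Pauli.I

/-! #### Slicing off the top qubit -/

/-- Fixing the top coordinate of a vector on `k + 1` qubits. [folklore] -/
def slice {k : ℕ} (b : Bool) (g : (Fin (k + 1) → Bool) → ℂ) : (Fin k → Bool) → ℂ :=
  fun x => g (Fin.cons b x)

/-- Slices of the zero vector. [folklore] -/
theorem slice_zero {k : ℕ} (b : Bool) : slice b (0 : (Fin (k + 1) → Bool) → ℂ) = 0 := rfl

/-- Slicing is linear (scalars). [folklore] -/
theorem slice_smul {k : ℕ} (b : Bool) (μ : ℂ) (g : (Fin (k + 1) → Bool) → ℂ) :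
    slice b (μ • g) = μ • slice b g := rfl

/-- The slices of a node are its edges: `|v⟩(b, ·) = |edge_b⟩`. [cite: VinkhuijzenEtAl2023, Def. 2 (semantics)] -/
theorem slice_nodeSem_succ {k : ℕ} (v : D.Node (k + 1)) (b : Bool) :
    slice b (D.nodeSem (k + 1) v) = edgeSem (D.label b v) (D.nodeSem k (D.child b v)) := by
  funext x
  simp only [slice, nodeSem, Fin.cons_zero, Fin.tail_cons]

/-- Entries of a Pauli string on `k + 1` qubits split off the top letter. [folklore] -/
theorem pauliString_cons_cons {k : ℕ} (P : Fin (k + 1) → Pauli) (b b' : Bool) (x y : Fin k → Bool) :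
    pauliString P (Fin.cons b x) (Fin.cons b' y) = (P 0).mat b b' * pauliString (Fin.tail P) x y := by
  simp only [pauliString_eq, tensorAll_apply]
  rw [Fin.prod_univ_succ]
  simp only [Fin.cons_zero, Fin.cons_succ, Fin.tail]

/-- Slicing a Pauli string applied to a vector: `(P g)(b, ·) = Σ_{b'} (P₀)_{b b'} · P' g(b', ·)`.
[cite: VinkhuijzenEtAl2023, §3.1 (amplitude read-off: ⟨x|A(|0⟩|low⟩ + |1⟩|high⟩))] -/
theorem slice_pauliString_mulVec {k : ℕ} (b : Bool) (P : Fin (k + 1) → Pauli)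
    (g : (Fin (k + 1) → Bool) → ℂ) :
    slice b ((pauliString P).mulVec g) =
      ∑ b' : Bool, (P 0).mat b b' • (pauliString (Fin.tail P)).mulVec (slice b' g) := by
  funext x
  simp only [slice, Finset.sum_apply, Pi.smul_apply, smul_eq_mul, Matrix.mulVec, dotProduct]
  rw [← (Fin.consEquiv fun _ => Bool).sum_comp, Fintype.sum_prod_type]
  refine Finset.sum_congr rfl fun b' _ => ?_
  rw [Finset.mul_sum]
  refine Finset.sum_congr rfl fun y _ => ?_
  show pauliString P (Fin.cons b x) (Fin.cons b' y) * g (Fin.cons b' y) = _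
  rw [pauliString_cons_cons, mul_assoc]

/-- **One level down**: a nonzero slice of a vector Pauli-isomorphic to `|v⟩` is Pauli-isomorphic
to a child of `v` (the top letter of the LIM selects the child, the rest of the LIM composes with
the edge label). [cite: VinkhuijzenEtAl2023, §3.1 (amplitude read-off) and VinkhuijzenCoopmansLaarman2024, App. A.2] -/
theorem descend {k : ℕ} (v : D.Node (k + 1)) {G : (Fin (k + 1) → Bool) → ℂ}
    (hG : PauliIso G (D.nodeSem (k + 1) v)) (b : Bool) (hb : slice b G ≠ 0) :
    ∃ w : D.Node k, PauliIso (slice b G) (D.nodeSem k w) := by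
  obtain ⟨P, μ, -, rfl⟩ := hG
  -- the top letter `P 0` sends the slice at `b` to the edge along `b₁ = b ⊕ flipsBit (P 0)`
  have key : slice b (μ • (pauliString P).mulVec (D.nodeSem (k + 1) v)) =
      (μ * ((P 0).rowPhase b * ((D.label (Bool.xor b (P 0).flipsBit) v).1 *
        stringPhase (Fin.tail P) (D.label (Bool.xor b (P 0).flipsBit) v).2))) •
        (pauliString (stringMul (Fin.tail P) (D.label (Bool.xor b (P 0).flipsBit) v).2)).mulVec
          (D.nodeSem k (D.child (Bool.xor b (P 0).flipsBit) v)) := by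
    rw [slice_smul, slice_pauliString_mulVec, Pauli.sum_mat_smul, slice_nodeSem_succ, edgeSem,
      Matrix.mulVec_smul, Matrix.mulVec_mulVec, pauliString_mul, Matrix.smul_mulVec]
    simp only [smul_smul]
  exact ⟨_, PauliIso.of_eq hb key⟩

/-- One level down in a QMDD (scalar version of `descend`). [cite: VinkhuijzenCoopmansLaarman2024, App. A.2] -/
theorem descend_scalar (hQ : D.IsQMDD) {k : ℕ} (v : D.Node (k + 1)) {G : (Fin (k + 1) → Bool) → ℂ}
    (hG : ScalarIso G (D.nodeSem (k + 1) v)) (b : Bool) (hb : slice b G ≠ 0) :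
    ∃ w : D.Node k, ScalarIso (slice b G) (D.nodeSem k w) := by
  obtain ⟨μ, -, rfl⟩ := hG
  have key : slice b (μ • D.nodeSem (k + 1) v) = (μ * (D.label b v).1) • D.nodeSem k (D.child b v) := by
    rw [slice_smul, slice_nodeSem_succ, edgeSem, hQ.1, pauliString_const_I, Matrix.one_mulVec, smul_smul]
  exact ⟨_, ScalarIso.of_eq hb key⟩

/-! #### Positional subfunctions and the path from the root -/

/-- The subfunction of a vector on `n` positions obtained by fixing the first `d` positions to `a`,
as a vector on the remaining `k` positions (`d + k = n`; local coordinate `i` is position `d + i`).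
[cite: VinkhuijzenCoopmansLaarman2024, App. A.2 (induced subfunction f_y)] -/
def posSub {d k n : ℕ} (h : d + k = n) (a : Fin d → Bool) (g : (Fin n → Bool) → ℂ) :
    (Fin k → Bool) → ℂ :=
  fun x => g fun j => if hj : (j : ℕ) < d then a ⟨j, hj⟩ else x ⟨(j : ℕ) - d, by have := j.2; omega⟩

/-- `Fin.cons` at a literal index `0`. [folklore] -/
theorem cons_mk_of_eq_zero {k : ℕ} (b : Bool) (x : Fin k → Bool) (m : ℕ) (hm : m < k + 1)
    (h0 : m = 0) : (Fin.cons b x : Fin (k + 1) → Bool) ⟨m, hm⟩ = b := by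
  subst h0
  rfl

/-- `Fin.cons` at a positive literal index. [folklore] -/
theorem cons_mk_of_pos {k : ℕ} (b : Bool) (x : Fin k → Bool) (m : ℕ) (hm : m < k + 1)
    (h0 : 0 < m) : (Fin.cons b x : Fin (k + 1) → Bool) ⟨m, hm⟩ =
      x ⟨m - 1, lt_of_lt_of_le (Nat.sub_lt h0 Nat.one_pos) (Nat.lt_succ_iff.mp hm)⟩ := by
  obtain ⟨m, rfl⟩ : ∃ m', m = m' + 1 := ⟨m - 1, by omega⟩
  exact Fin.cons_succ (α := fun _ => Bool) b x ⟨m, Nat.lt_of_succ_lt_succ hm⟩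

/-- Fixing no position does nothing. [folklore] -/
theorem posSub_zero {k n : ℕ} (h : 0 + k = n) (a : Fin 0 → Bool) (g : (Fin n → Bool) → ℂ)
    (x : Fin k → Bool) : posSub h a g x = g fun j => x ⟨j, by have := j.2; omega⟩ := by
  simp only [posSub]
  congr 1

/-- Fixing `d + 1` positions = fixing `d` positions, then slicing off the next one. [folklore] -/
theorem posSub_succ {d k n : ℕ} (h : d + 1 + k = n) (a : Fin (d + 1) → Bool) (g : (Fin n → Bool) → ℂ) :
    posSub h a g = slice (a (Fin.last d)) (posSub (show d + (k + 1) = n by omega) (Fin.init a) g) := by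
  funext x
  simp only [posSub, slice]
  congr 1
  funext j
  by_cases h1 : (j : ℕ) < d
  · rw [dif_pos (show (j : ℕ) < d + 1 by omega), dif_pos h1]
    rfl
  · rw [dif_neg h1]
    by_cases h2 : (j : ℕ) < d + 1
    · rw [dif_pos h2, cons_mk_of_eq_zero]
      · congr 1
        exact Fin.ext (show (j : ℕ) = (Fin.last d : ℕ) by rw [Fin.val_last]; omega)
      · omega
    · rw [dif_neg h2, cons_mk_of_pos]
      · rfl
      · omega

/-- **Every nonzero induced subfunction is Pauli-isomorphic to a node of the matching index**
(following the bits of the prefix from the root; every Pauli-LIMDD, reduced or not).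
[cite: VinkhuijzenCoopmansLaarman2024, App. A.2 ("for any y_n…y_k the diagram contains a node
which represents … a function isomorphic to f_y")] -/
theorem exists_node_of_posSub_ne_zero (D : PauliLIMDD n) (d : ℕ) :
    ∀ {k : ℕ} (h : d + k = n) (a : Fin d → Bool), posSub h a D.rootSem ≠ 0 →
      ∃ w : D.Node k, PauliIso (posSub h a D.rootSem) (D.nodeSem k w) := by
  induction d with
  | zero =>
    intro k h a hne
    obtain rfl : k = n := by omega
    have hid : posSub h a D.rootSem = D.rootSem := by
      funext x
      rw [posSub_zero]
    rw [hid] at hne ⊢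
    exact ⟨D.root, PauliIso.of_eq hne D.rootSem_eq⟩
  | succ d ih =>
    intro k h a hne
    have h' : d + (k + 1) = n := by omega
    rw [posSub_succ h a] at hne ⊢
    have hne' : posSub h' (Fin.init a) D.rootSem ≠ 0 := by
      intro h0
      apply hne
      rw [h0]
      rfl
    obtain ⟨v, hv⟩ := ih h' (Fin.init a) hne'
    exact D.descend v hv _ hne

/-- QMDD version of `exists_node_of_posSub_ne_zero`: in a QMDD every nonzero induced subfunction
is a scalar multiple of a node. [cite: VinkhuijzenCoopmansLaarman2024, App. A.2 and Prop. 1 (E_k = ℂ)] -/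
theorem exists_node_of_posSub_ne_zero_scalar (D : PauliLIMDD n) (hQ : D.IsQMDD) (d : ℕ) :
    ∀ {k : ℕ} (h : d + k = n) (a : Fin d → Bool), posSub h a D.rootSem ≠ 0 →
      ∃ w : D.Node k, ScalarIso (posSub h a D.rootSem) (D.nodeSem k w) := by
  induction d with
  | zero =>
    intro k h a hne
    obtain rfl : k = n := by omega
    have hid : posSub h a D.rootSem = D.rootSem := by
      funext x
      rw [posSub_zero]
    rw [hid] at hne ⊢
    refine ⟨D.root, ScalarIso.of_eq (μ := D.rootLabel.1) hne ?_⟩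
    rw [D.rootSem_eq, hQ.2, pauliString_const_I, Matrix.one_mulVec]
  | succ d ih =>
    intro k h a hne
    have h' : d + (k + 1) = n := by omega
    rw [posSub_succ h a] at hne ⊢
    have hne' : posSub h' (Fin.init a) D.rootSem ≠ 0 := by
      intro h0
      apply hne
      rw [h0]
      rfl
    obtain ⟨v, hv⟩ := ih h' (Fin.init a) hne'
    exact D.descend_scalar hQ v hv _ hne

/-! #### From variable orders on `ι` to positions -/

variable {ι : Type*} [Fintype ι] [DecidableEq ι]

/-- **Bridge**: in local coordinates, the induced subfunction of `f` at the prefix of the first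
`d` variables is the positional subfunction of the represented vector. [folklore] -/
theorem reindexFun_subfunctionAt_prefixVars (σ : Fin n ≃ ι) {f : (ι → Bool) → ℂ}
    (hD : D.Represents σ f) {d k : ℕ} (h : d + k = n) (u : ι → Bool) :
    reindexFun (suffixEquiv σ h).symm (subfunctionAt (prefixVars σ d) f u) =
      posSub h (fun j => u (σ (Fin.castLE (by omega) j))) D.rootSem := by
  funext x
  simp only [reindexFun, subfunctionAt, posSub]
  rw [hD]
  congr 1
  funext i
  by_cases hi : i ∈ prefixVars σ d
  · have hlt : ((σ.symm i : Fin n) : ℕ) < d := mem_prefixVars.mp hi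
    rw [dif_pos hi, dif_pos hlt]
    congr 1
    symm
    rw [Equiv.apply_eq_iff_eq_symm_apply]
    exact Fin.ext rfl
  · have hlt : ¬ ((σ.symm i : Fin n) : ℕ) < d := fun h' => hi (mem_prefixVars.mpr h')
    rw [dif_neg hi, dif_neg hlt]
    rfl

/-- **Pauli-LIMDD width is a lower bound on the level sizes of every Pauli-LIMDD**: if `D`
represents `f` in the variable order `σ` and `d + k = n`, then `D` has at least
`limClassCount (prefixVars σ d) f` (= `pauliLIMDDWidth σ d f`) nodes of index `k` — pairwise
non-isomorphic nonzero cofactors need distinct nodes.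
[cite: VinkhuijzenCoopmansLaarman2024, Prop. 1 (lower-bound direction) and Lemma 4] -/
theorem limClassCount_le_card (σ : Fin n ≃ ι) {f : (ι → Bool) → ℂ} (hD : D.Represents σ f)
    {d k : ℕ} (h : d + k = n) :
    limClassCount (prefixVars σ d) f ≤ Fintype.card (D.Node k) := by
  classical
  obtain ⟨A, hcard, hnz, hpair, -⟩ := exists_limClassCount_transversal (prefixVars σ d) f
  rw [← hcard]
  set e := suffixEquiv σ h with he
  set pref : (ι → Bool) → Fin d → Bool := fun u j => u (σ (Fin.castLE (by omega) j)) with hpref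
  have hG : ∀ u, reindexFun e.symm (subfunctionAt (prefixVars σ d) f u) = posSub h (pref u) D.rootSem :=
    fun u => D.reindexFun_subfunctionAt_prefixVars σ hD h u
  have hne : ∀ u ∈ A, posSub h (pref u) D.rootSem ≠ 0 := by
    intro u hu
    rw [← hG, Ne, reindexFun_eq_zero_iff]
    exact hnz u hu
  choose w hw using fun u : ↥A => D.exists_node_of_posSub_ne_zero d h (pref u) (hne u u.2)
  have hinj : Function.Injective w := by
    intro u u' huu'
    apply Subtype.ext
    by_contra hne'
    refine hpair u u.2 u' u'.2 hne' (PauliIso.of_reindex e.symm ?_)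
    rw [hG, hG]
    refine (hw u).trans ?_
    rw [huu']
    exact (hw u').symm
  simpa only [Fintype.card_coe] using Fintype.card_le_of_injective w hinj

/-- The same bound for `pauliLIMDDWidth`. [cite: VinkhuijzenCoopmansLaarman2024, Prop. 1 and Lemma 4] -/
theorem pauliLIMDDWidth_le_card (σ : Fin n ≃ ι) {f : (ι → Bool) → ℂ} (hD : D.Represents σ f)
    {d k : ℕ} (h : d + k = n) : pauliLIMDDWidth σ d f ≤ Fintype.card (D.Node k) :=
  D.limClassCount_le_card σ hD h

/-- **QMDD width is a lower bound on the level sizes of every QMDD** representing `f` in the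
order `σ`. [cite: VinkhuijzenCoopmansLaarman2024, Prop. 1 (E_k = ℂ)] -/
theorem sliceClassCount_le_card_of_isQMDD (hQ : D.IsQMDD) (σ : Fin n ≃ ι) {f : (ι → Bool) → ℂ}
    (hD : D.Represents σ f) {d k : ℕ} (h : d + k = n) :
    sliceClassCount (prefixVars σ d) f ≤ Fintype.card (D.Node k) := by
  classical
  obtain ⟨A, hcard, hnz, hpair, -⟩ := exists_sliceClassCount_transversal (prefixVars σ d) f
  rw [← hcard]
  set e := suffixEquiv σ h with he
  set pref : (ι → Bool) → Fin d → Bool := fun u j => u (σ (Fin.castLE (by omega) j)) with hpref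
  have hG : ∀ u, reindexFun e.symm (subfunctionAt (prefixVars σ d) f u) = posSub h (pref u) D.rootSem :=
    fun u => D.reindexFun_subfunctionAt_prefixVars σ hD h u
  have hne : ∀ u ∈ A, posSub h (pref u) D.rootSem ≠ 0 := by
    intro u hu
    rw [← hG, Ne, reindexFun_eq_zero_iff]
    exact hnz u hu
  choose w hw using fun u : ↥A => D.exists_node_of_posSub_ne_zero_scalar hQ d h (pref u) (hne u u.2)
  have hinj : Function.Injective w := by
    intro u u' huu'
    apply Subtype.ext
    by_contra hne'
    refine hpair u u.2 u' u'.2 hne' (ScalarIso.of_reindex e.symm ?_)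
    rw [hG, hG]
    refine (hw u).trans ?_
    rw [huu']
    exact (hw u').symm
  simpa only [Fintype.card_coe] using Fintype.card_le_of_injective w hinj

/-- Consequently the Schmidt rank across the cut after the first `d` variables bounds the level
sizes of every QMDD from below (QMDD = SLDD× is an MPS with bond dimensions the level sizes).
[cite: VinkhuijzenCoopmansLaarman2024, Lemma 39 (SLDD× to MPS) and Prop. 1] -/
theorem rank_unfolding_le_card_of_isQMDD (hQ : D.IsQMDD) (σ : Fin n ≃ ι) {f : (ι → Bool) → ℂ}
    (hD : D.Represents σ f) {d k : ℕ} (h : d + k = n) :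
    (unfolding (prefixVars σ d) f).rank ≤ Fintype.card (D.Node k) :=
  (rank_unfolding_le_sliceClassCount _ _).trans (D.sliceClassCount_le_card_of_isQMDD hQ σ hD h)

end PauliLIMDD

end Literature.Computability.QuantumComplexity
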